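import Mathlib
import HarnessLib
import Summits.Parity.GeneralizedHardyLittlewood.Theorems.LeeYangFibresAbsoluteUpgradeDefs
import Summits.Parity.GeneralizedHardyLittlewood.Theorems.LeeYangFibresAbsoluteUpgradeWalshClippingAux

/-!
# `stub_walshClipping` — the finite-dimensional clipping lemma on the corner `{1,2,3}^t`, all `t`

Crux `AbsoluteUpgrade` (stmt-Parity-14116), line `nlc-cells-absolute-clip`, registered stub
`stub_walshClipping : WalshClipping` (vocabulary: `Theorems/LeeYangFibresAbsoluteUpgradeDefs.lean`; Walsh–Fourier helpers:
`Theorems/LeeYangFibresAbsoluteUpgradeWalshClippingAux.lean`).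

**Statement.** For each `t` there are `c₀ > 0` and `C` such that: if cells `c_j ≥ 0` on the corner
`j ∈ {1,2,3}^t` are `δ`-close to a Walsh form `Θ_θ(σ(j)) = Σ_S θ_S ∏_{i∈S} (-1)^{j_i+1}` (`θ_∅ = 1`,
`|θ_S| ≤ 2`), satisfy the negative lattice condition `c_{j∨j'} c_{j∧j'} ≤ c_j c_{j'} + η` on the corner,
and the singles are small, `|θ_{{i}}| ≤ τ`, with `δ + η + τ ≤ c₀`, then `|Θ_θ(𝟙) − 1| ≤ C (δ + η + τ)`.

**Proof (line lead, explicit `c₀ = 1`, `C = 2^t (8·2^t + 2)`).** Write `Θ(D, b)` for the value of the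
Walsh form at the sign pattern "`b` at `i₀`, `−1` on `D`, `+1` elsewhere" (`D ⊆ U := [t] ∖ {i₀}`).
For `D, E ⊆ U` the corner pair `j = (1 at i₀; 2 on D; 3 on E∖D; 1 else)`, `j' = (2 at i₀; 2 on E; 1 else)`
has `σ(j) = (D,+)`, `σ(j') = (E,−)`, `σ(j ∨ j') = (D,−)`, `σ(j ∧ j') = (E,+)`, so NLC and `δ`-closeness
give `Θ(D,−)Θ(E,+) ≤ Θ(D,+)Θ(E,−) + η'` with `η' = η + 2(2Bδ + δ²)`, `B = 2·2^t ≥ |Θ|`; exchanging the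
roles of `D` and `E` gives the reverse inequality, hence `|Θ(D,+)Θ(E,−) − Θ(D,−)Θ(E,+)| ≤ η'`.  Summing
over `E ⊆ U` and using the marginal sums `Σ_E Θ(E, ±) = 2^{|U|}(1 ± θ_{{i₀}})` (orthogonality of the
Walsh characters) yields `|Θ(D,+) − Θ(D,−)| ≤ η' + 2Bτ =: κ`; and Walsh inversion in the coordinates of
`U` (`Σ_D (−1)^{|S₀∩D|}(Θ(D,+) − Θ(D,−)) = 2·2^{|U|} θ_{S₀}` for `S₀ ∋ i₀`) gives `|θ_{S₀}| ≤ κ/2`.  Every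
`S ≠ ∅` contains some `i₀`, so `|Θ(𝟙) − 1| = |Σ_{S≠∅} θ_S| ≤ 2^t κ ≤ 2^t(8·2^t + 2)(δ + η + τ)` (using
`δ ≤ 1`).  Non-negativity of the cells is not needed.

References: the `t = 2` instance is the kernel-checked mechanism lemma `nlc_clips_mixed_amplitude` of the
skeleton (`(2,1)∨(1,2)`, `(3,1)∨(2,2)` read `±4σσ'(θ₁₂ − θ₁θ₂) ≤ η + O(δ)`); Walsh–Fourier analysis on
`{±1}^t` is folklore.
-/

noncomputable section

open scoped BigOperators Classical
open Finset

/-! ## The proof -/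

namespace Summit.Parity.GeneralizedHardyLittlewood.Theorems.AbsoluteUpgrade

open Summit.Parity.GeneralizedHardyLittlewood.Cruxes.AbsoluteUpgrade.NlcCellsAbsoluteClip

namespace WalshClip

variable {t : ℕ}

/-- The route's `walshForm θ j` is `wEval θ` at the sign vector `σ(j)_i = (-1)^{j_i+1}`. [folklore] -/
theorem walshForm_eq_wEval (θ : Finset (Fin t) → ℝ) (j : Fin t → ℕ) :
    walshForm θ j = wEval θ (fun i => (-1 : ℝ) ^ (j i + 1)) := rfl

/-! ### The corner index vectors realising a single-coordinate swap -/

/-- `j = (1 at i₀; 2 on D; 3 on E ∖ D; 1 else)`: `σ(j) = (D, +)`. [folklore] -/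
def jTop (i₀ : Fin t) (D E : Finset (Fin t)) : Fin t → ℕ :=
  fun i => if i = i₀ then 1 else if i ∈ D then 2 else if i ∈ E then 3 else 1

/-- `j' = (2 at i₀; 2 on E; 1 else)`: `σ(j') = (E, −)`. [folklore] -/
def jBot (i₀ : Fin t) (E : Finset (Fin t)) : Fin t → ℕ :=
  fun i => if i = i₀ then 2 else if i ∈ E then 2 else 1

/-- `j` lies in the corner `{1,2,3}^t`. [folklore] -/
theorem isCorner_jTop (i₀ : Fin t) (D E : Finset (Fin t)) : IsCorner (jTop i₀ D E) := by
  intro i; unfold jTop; split_ifs <;> omega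

/-- `j'` lies in the corner `{1,2,3}^t`. [folklore] -/
theorem isCorner_jBot (i₀ : Fin t) (E : Finset (Fin t)) : IsCorner (jBot i₀ E) := by
  intro i; unfold jBot; split_ifs <;> omega

/-- The corner is a sublattice: `j ∨ j'` stays in `{1,2,3}^t`. [folklore] -/
theorem isCorner_sup {j j' : Fin t → ℕ} (hj : IsCorner j) (hj' : IsCorner j') : IsCorner (j ⊔ j') := by
  intro i
  have h1 := hj i; have h2 := hj' i
  rw [Pi.sup_apply]
  exact ⟨le_sup_of_le_left h1.1, sup_le h1.2 h2.2⟩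

/-- The corner is a sublattice: `j ∧ j'` stays in `{1,2,3}^t`. [folklore] -/
theorem isCorner_inf {j j' : Fin t → ℕ} (hj : IsCorner j) (hj' : IsCorner j') : IsCorner (j ⊓ j') := by
  intro i
  have h1 := hj i; have h2 := hj' i
  rw [Pi.inf_apply]
  exact ⟨le_inf h1.1 h2.1, inf_le_of_left_le h1.2⟩

/-- `σ(j) = (D,+)`. [folklore] -/
theorem sign_jTop (i₀ : Fin t) (D E : Finset (Fin t)) :
    (fun i => (-1 : ℝ) ^ (jTop i₀ D E i + 1)) = pat i₀ D 1 := by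
  funext i
  unfold jTop pat
  by_cases hi : i = i₀ <;> by_cases hD : i ∈ D <;> by_cases hE : i ∈ E <;> simp [hi, hD, hE] <;> norm_num

/-- `σ(j') = (E,−)`. [folklore] -/
theorem sign_jBot (i₀ : Fin t) (E : Finset (Fin t)) :
    (fun i => (-1 : ℝ) ^ (jBot i₀ E i + 1)) = pat i₀ E (-1) := by
  funext i
  unfold jBot pat
  by_cases hi : i = i₀ <;> by_cases hE : i ∈ E <;> simp [hi, hE] <;> norm_num

/-- `σ(j ∨ j') = (D,−)`. [folklore] -/
theorem sign_sup (i₀ : Fin t) (D E : Finset (Fin t)) :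
    (fun i => (-1 : ℝ) ^ ((jTop i₀ D E ⊔ jBot i₀ E) i + 1)) = pat i₀ D (-1) := by
  funext i
  simp only [Pi.sup_apply]
  unfold jTop jBot pat
  by_cases hi : i = i₀ <;> by_cases hD : i ∈ D <;> by_cases hE : i ∈ E <;> simp [hi, hD, hE] <;> norm_num

/-- `σ(j ∧ j') = (E,+)`. [folklore] -/
theorem sign_inf (i₀ : Fin t) (D E : Finset (Fin t)) :
    (fun i => (-1 : ℝ) ^ ((jTop i₀ D E ⊓ jBot i₀ E) i + 1)) = pat i₀ E 1 := by
  funext i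
  simp only [Pi.inf_apply]
  unfold jTop jBot pat
  by_cases hi : i = i₀ <;> by_cases hD : i ∈ D <;> by_cases hE : i ∈ E <;> simp [hi, hD, hE] <;> norm_num

/-! ### Elementary inequalities -/

/-- `|xy - XY| ≤ 2Bδ + δ²` if `x, y` are `δ`-close to `X, Y` with `|X|, |Y| ≤ B`. [folklore] -/
theorem abs_mul_sub_mul_le {x y X Y δ B : ℝ} (hx : |x - X| ≤ δ) (hy : |y - Y| ≤ δ) (hX : |X| ≤ B)
    (hY : |Y| ≤ B) (hδ : 0 ≤ δ) : |x * y - X * Y| ≤ 2 * B * δ + δ ^ 2 := by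
  have hB : 0 ≤ B := (abs_nonneg X).trans hX
  have key : x * y - X * Y = (x - X) * Y + X * (y - Y) + (x - X) * (y - Y) := by ring
  rw [key]
  calc |(x - X) * Y + X * (y - Y) + (x - X) * (y - Y)|
      ≤ |(x - X) * Y| + |X * (y - Y)| + |(x - X) * (y - Y)| := abs_add_three _ _ _
    _ = |x - X| * |Y| + |X| * |y - Y| + |x - X| * |y - Y| := by simp only [abs_mul]
    _ ≤ δ * B + B * δ + δ * δ := by gcongr
    _ = 2 * B * δ + δ ^ 2 := by ring

end WalshClip

open WalshClip in
/-- **Stub 4 of the line `nlc-cells-absolute-clip` (all `t`): the corner negative-lattice inequalities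
clip the Walsh form at the prime corner linearly in the slacks** — `WalshClipping` with `c₀ = 1` and
`C = 2^t (8·2^t + 2)`.  See the module docstring for the proof. [folklore] -/
theorem stub_walshClipping : WalshClipping := by
  intro t
  refine ⟨1, one_pos, 2 ^ t * (8 * 2 ^ t + 2), ?_⟩
  intro θ c δ η τ hδ hη hτ hsum hθ0 hθ2 hθ1 hlaw hnlc
  -- constants
  set B : ℝ := 2 * 2 ^ t with hB
  have hB0 : 0 ≤ B := by positivity
  have hδ1 : δ ≤ 1 := by linarith
  set ε₁ : ℝ := 2 * B * δ + δ ^ 2 with hε₁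
  set η' : ℝ := η + 2 * ε₁ with hη'
  set κ : ℝ := η' + 2 * B * τ with hκ
  -- |Θ| ≤ B at every pattern
  have hΘ : ∀ (i₀ : Fin t) (D : Finset (Fin t)) (b : ℝ), |b| = 1 → |wEval θ (pat i₀ D b)| ≤ B :=
    fun i₀ D b hb => abs_wEval_le hθ2 (abs_pat hb)
  have hb1 : |(1 : ℝ)| = 1 := abs_one
  have hbm1 : |(-1 : ℝ)| = 1 := by norm_num
  -- Step 1: the single-coordinate swap inequality, one direction
  have step1 : ∀ (i₀ : Fin t) (D E : Finset (Fin t)),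
      wEval θ (pat i₀ D (-1)) * wEval θ (pat i₀ E 1) ≤
        wEval θ (pat i₀ D 1) * wEval θ (pat i₀ E (-1)) + η' := by
    intro i₀ D E
    have hT := isCorner_jTop i₀ D E
    have hBt := isCorner_jBot i₀ E
    have hN := hnlc _ _ hT hBt
    -- closeness at the four corner indices
    have e1 := (hlaw _ hT).2
    have e2 := (hlaw _ hBt).2
    have e3 := (hlaw _ (isCorner_sup hT hBt)).2
    have e4 := (hlaw _ (isCorner_inf hT hBt)).2
    rw [walshForm_eq_wEval, sign_jTop] at e1
    rw [walshForm_eq_wEval, sign_jBot] at e2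
    rw [walshForm_eq_wEval, sign_sup] at e3
    rw [walshForm_eq_wEval, sign_inf] at e4
    have P1 := abs_mul_sub_mul_le e1 e2 (hΘ i₀ D 1 hb1) (hΘ i₀ E (-1) hbm1) hδ
    have P2 := abs_mul_sub_mul_le e3 e4 (hΘ i₀ D (-1) hbm1) (hΘ i₀ E 1 hb1) hδ
    obtain ⟨_, hP1⟩ := abs_le.mp P1
    obtain ⟨hP2, _⟩ := abs_le.mp P2
    rw [hη']
    linarith
  -- Step 2: both directions
  have step2 : ∀ (i₀ : Fin t) (D E : Finset (Fin t)),
      |wEval θ (pat i₀ D 1) * wEval θ (pat i₀ E (-1)) -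
        wEval θ (pat i₀ D (-1)) * wEval θ (pat i₀ E 1)| ≤ η' := by
    intro i₀ D E
    have h1 := step1 i₀ D E
    have h2 := step1 i₀ E D
    rw [abs_le]; constructor <;> linarith
  -- Step 3: |Θ(D,+) − Θ(D,−)| ≤ κ
  have step3 : ∀ (i₀ : Fin t) (D : Finset (Fin t)),
      |wEval θ (pat i₀ D 1) - wEval θ (pat i₀ D (-1))| ≤ κ := by
    intro i₀ D
    set U : Finset (Fin t) := Finset.univ.erase i₀ with hU
    have hU0 : (0 : ℝ) < (2 : ℝ) ^ U.card := by positivity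
    -- sum step2 over E ⊆ U
    have hS : |∑ E ∈ U.powerset, (wEval θ (pat i₀ D 1) * wEval θ (pat i₀ E (-1)) -
        wEval θ (pat i₀ D (-1)) * wEval θ (pat i₀ E 1))| ≤ (2 : ℝ) ^ U.card * η' := by
      calc _ ≤ ∑ E ∈ U.powerset, |wEval θ (pat i₀ D 1) * wEval θ (pat i₀ E (-1)) -
              wEval θ (pat i₀ D (-1)) * wEval θ (pat i₀ E 1)| := Finset.abs_sum_le_sum_abs _ _
        _ ≤ ∑ _E ∈ U.powerset, η' := Finset.sum_le_sum fun E _ => step2 i₀ D E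
        _ = (2 : ℝ) ^ U.card * η' := by
            rw [Finset.sum_const, nsmul_eq_mul, Finset.card_powerset]; push_cast; ring
    have hsplit : ∑ E ∈ U.powerset, (wEval θ (pat i₀ D 1) * wEval θ (pat i₀ E (-1)) -
        wEval θ (pat i₀ D (-1)) * wEval θ (pat i₀ E 1)) =
        wEval θ (pat i₀ D 1) * ((2 : ℝ) ^ U.card * (1 + (-1) * θ {i₀})) -
          wEval θ (pat i₀ D (-1)) * ((2 : ℝ) ^ U.card * (1 + 1 * θ {i₀})) := by
      rw [Finset.sum_sub_distrib, ← Finset.mul_sum, ← Finset.mul_sum, sum_wEval_pat θ hθ0 i₀ (-1),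
        sum_wEval_pat θ hθ0 i₀ 1]
    rw [hsplit] at hS
    -- cancel 2^{|U|}
    have hS' : |wEval θ (pat i₀ D 1) * (1 - θ {i₀}) - wEval θ (pat i₀ D (-1)) * (1 + θ {i₀})| ≤ η' := by
      have heq : wEval θ (pat i₀ D 1) * ((2 : ℝ) ^ U.card * (1 + (-1) * θ {i₀})) -
          wEval θ (pat i₀ D (-1)) * ((2 : ℝ) ^ U.card * (1 + 1 * θ {i₀})) =
          (2 : ℝ) ^ U.card * (wEval θ (pat i₀ D 1) * (1 - θ {i₀}) -
            wEval θ (pat i₀ D (-1)) * (1 + θ {i₀})) := by ring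
      rw [heq, abs_mul, abs_of_pos hU0] at hS
      exact le_of_mul_le_mul_left hS hU0
    -- the singles
    have hτ0 := hθ1 i₀
    have hA := hΘ i₀ D 1 hb1
    have hAm := hΘ i₀ D (-1) hbm1
    have key : wEval θ (pat i₀ D 1) - wEval θ (pat i₀ D (-1)) =
        (wEval θ (pat i₀ D 1) * (1 - θ {i₀}) - wEval θ (pat i₀ D (-1)) * (1 + θ {i₀})) +
          θ {i₀} * (wEval θ (pat i₀ D 1) + wEval θ (pat i₀ D (-1))) := by ring
    rw [key]
    calc _ ≤ |wEval θ (pat i₀ D 1) * (1 - θ {i₀}) - wEval θ (pat i₀ D (-1)) * (1 + θ {i₀})| +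
          |θ {i₀} * (wEval θ (pat i₀ D 1) + wEval θ (pat i₀ D (-1)))| := abs_add_le _ _
      _ ≤ η' + τ * (B + B) := by
          refine add_le_add hS' ?_
          rw [abs_mul]
          exact mul_le_mul hτ0 ((abs_add_le _ _).trans (add_le_add hA hAm)) (abs_nonneg _)
            ((abs_nonneg _).trans hτ0)
      _ = κ := by rw [hκ]; ring
  -- Step 4: |θ_S| ≤ κ/2 for every nonempty S
  have step4 : ∀ S : Finset (Fin t), S ≠ ∅ → |θ S| ≤ κ / 2 := by
    intro S hS
    obtain ⟨i₀, h₀⟩ := Finset.nonempty_iff_ne_empty.mpr hS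
    set U : Finset (Fin t) := Finset.univ.erase i₀ with hU
    have hU0 : (0 : ℝ) < (2 : ℝ) ^ U.card := by positivity
    have hinv := walshInversion θ h₀
    have hbound : |∑ D ∈ U.powerset,
        (∏ i ∈ D, ySign S i) * (wEval θ (pat i₀ D 1) - wEval θ (pat i₀ D (-1)))| ≤
        (2 : ℝ) ^ U.card * κ := by
      calc _ ≤ ∑ D ∈ U.powerset,
            |(∏ i ∈ D, ySign S i) * (wEval θ (pat i₀ D 1) - wEval θ (pat i₀ D (-1)))| :=
            Finset.abs_sum_le_sum_abs _ _
        _ ≤ ∑ _D ∈ U.powerset, κ := Finset.sum_le_sum fun D _ => by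
            rw [abs_mul, prod_ySign, abs_neg_one_pow, one_mul]
            exact step3 i₀ D
        _ = (2 : ℝ) ^ U.card * κ := by
            rw [Finset.sum_const, nsmul_eq_mul, Finset.card_powerset]; push_cast; ring
    rw [hinv] at hbound
    have h2 : 2 * (2 : ℝ) ^ U.card * θ S = (2 : ℝ) ^ U.card * (2 * θ S) := by ring
    rw [h2, abs_mul, abs_of_pos hU0] at hbound
    have h3 : |2 * θ S| ≤ κ := le_of_mul_le_mul_left hbound hU0
    rw [abs_mul, abs_two] at h3
    linarith
  -- Step 5: Θ(𝟙) − 1 = Σ_{S ≠ ∅} θ_S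
  have hone : walshForm θ (fun _ => 1) = ∑ S : Finset (Fin t), θ S := by
    unfold walshForm
    refine Finset.sum_congr rfl fun S _ => ?_
    rw [Finset.prod_eq_one fun i _ => by norm_num, mul_one]
  have hsplit : ∑ S : Finset (Fin t), θ S = θ ∅ + ∑ S ∈ Finset.univ.erase ∅, θ S :=
    (Finset.add_sum_erase _ _ (Finset.mem_univ _)).symm
  rw [hone, hsplit, hθ0, add_sub_cancel_left]
  have hcard : ((Finset.univ.erase (∅ : Finset (Fin t))).card : ℝ) ≤ 2 ^ t := by
    have h := Finset.card_erase_le (s := (Finset.univ : Finset (Finset (Fin t)))) (a := ∅)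
    rw [Finset.card_univ, Fintype.card_finset, Fintype.card_fin] at h
    exact_mod_cast h
  have hκ0 : 0 ≤ κ := by rw [hκ, hη', hε₁]; positivity
  calc |∑ S ∈ Finset.univ.erase ∅, θ S|
      ≤ ∑ S ∈ Finset.univ.erase ∅, |θ S| := Finset.abs_sum_le_sum_abs _ _
    _ ≤ ∑ _S ∈ Finset.univ.erase (∅ : Finset (Fin t)), κ / 2 :=
        Finset.sum_le_sum fun S hS => step4 S (Finset.ne_of_mem_erase hS)
    _ = ((Finset.univ.erase (∅ : Finset (Fin t))).card : ℝ) * (κ / 2) := by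
        rw [Finset.sum_const, nsmul_eq_mul]
    _ ≤ 2 ^ t * (κ / 2) := by gcongr
    _ ≤ 2 ^ t * κ := by
        gcongr
        linarith
    _ ≤ 2 ^ t * ((8 * 2 ^ t + 2) * (δ + η + τ)) := by
        gcongr
        -- κ = η + 2(2Bδ + δ²) + 2Bτ ≤ (4B + 2)(δ + η + τ), B = 2·2^t
        have hδ2 : δ ^ 2 ≤ δ := by nlinarith
        have h4B : (0 : ℝ) ≤ 8 * 2 ^ t + 1 := by positivity
        rw [hκ, hη', hε₁, hB]
        nlinarith [mul_nonneg h4B hη, mul_nonneg h4B hτ, mul_nonneg hB0 hδ]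
    _ = 2 ^ t * (8 * 2 ^ t + 2) * (δ + η + τ) := by ring

end Summit.Parity.GeneralizedHardyLittlewood.Theorems.AbsoluteUpgrade

end
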